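import Literature.NumberTheory.Transcendental.BKModelGeneric
import Literature.NumberTheory.Transcendental.EclPredim
import Literature.NumberTheory.Transcendental.AxiomFourTransfer
import Mathlib.FieldTheory.IsAlgClosed.AlgebraicClosure
import Mathlib.Algebra.MvPolynomial.Cardinal
import Mathlib.RingTheory.Localization.Cardinality
import Mathlib.RingTheory.Algebraic.Cardinality
import Mathlib.SetTheory.Cardinal.Subfield
import HarnessLib

/-!
# The countable model over a partial exponential field, III: the ambient field and the limit

M. Bays, J. Kirby, *Pseudo-exponential maps, variants, and quasiminimality*, Algebra & Number
Theory 12 (2018), Thm 5.9 / Notation 5.10 and §9.2: the countable full kernel-preserving strongly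
exponentially-algebraically closed strong extension `M(F_base)` of a finitely generated partial
exponential field with standard kernel `F_base = (K, D, θ, τ)`. We realise it on the countable
algebraically closed field `Ω = (Frac K[X₀, X₁, …])^alg` (infinite transcendence degree over
`K`, so fresh transcendentals are always available: `BKModel.exists_fresh`) as the union of
an `ω`-chain of stages (`BKModelStages`, `BKModelGeneric`) scheduled so that every element gets an
exponential and a logarithm, generic points of `G¹` are adjoined infinitely often, and every
admissible point-adjunction task is performed infinitely often.

## References

* M. Bays, J. Kirby, *Pseudo-exponential maps, variants, and quasiminimality*, Algebra & Number
  Theory 12 (2018) 493–549: Thm 5.9, Notation 5.10, Lemma 8.3, §9.2.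
-/

noncomputable section

open Set MvPolynomial Cardinal

namespace Literature.NumberTheory.Transcendental

namespace BKModel

open GammaField Literature.ModelTheory.ExponentialFields Literature.FieldTheory.AlgClosed
open Literature.ModelTheory.ExponentialFields.ExponentialRing

universe u

/-! ### The ambient field `Ω = (Frac K[X_ℕ])^alg` -/

section Ambient

variable (K : Type u) [Field K] [CharZero K]

/-- The ambient field `Ω_K = (Frac K[X₀, X₁, …])^alg`. [folklore] -/
abbrev Om : Type u := AlgebraicClosure (FractionRing (MvPolynomial ℕ K))

/-- The embedding `K → Ω_K`. [folklore] -/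
def emb : K →+* Om K :=
  (algebraMap (FractionRing (MvPolynomial ℕ K)) (Om K)).comp
    ((algebraMap (MvPolynomial ℕ K) (FractionRing (MvPolynomial ℕ K))).comp MvPolynomial.C)

/-- The variables `Xᵢ` in `Ω_K`. [folklore] -/
def var (i : ℕ) : Om K :=
  algebraMap (FractionRing (MvPolynomial ℕ K)) (Om K)
    (algebraMap (MvPolynomial ℕ K) (FractionRing (MvPolynomial ℕ K)) (X i))

omit [CharZero K] in
/-- The canonical map `K[X_ℕ] → Ω_K` is injective. [folklore] -/
theorem toOm_injective :
    Function.Injective ((algebraMap (FractionRing (MvPolynomial ℕ K)) (Om K)).comp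
      (algebraMap (MvPolynomial ℕ K) (FractionRing (MvPolynomial ℕ K)))) :=
  (algebraMap (FractionRing (MvPolynomial ℕ K)) (Om K)).injective.comp
    (IsFractionRing.injective (MvPolynomial ℕ K) _)

/-- `Ω_K` has characteristic zero. [folklore] -/
instance : CharZero (Om K) :=
  charZero_of_injective_algebraMap (algebraMap (FractionRing (MvPolynomial ℕ K)) (Om K)).injective

omit [CharZero K] in
/-- `Ω_K` is countable when `K` is. [folklore] -/
theorem countable_om [Countable K] : Countable (Om K) := by
  have h1 : #(MvPolynomial ℕ K) ≤ ℵ₀ := by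
    refine (MvPolynomial.cardinalMk_le_max_lift (σ := ℕ) (R := K)).trans ?_
    refine sup_le (sup_le ?_ ?_) le_rfl
    · exact Cardinal.lift_le_aleph0.2 Cardinal.mk_le_aleph0
    · simp
  have h2 : #(FractionRing (MvPolynomial ℕ K)) ≤ ℵ₀ := by rw [Cardinal.mk_fractionRing]; exact h1
  have h3 : #(Om K) ≤ ℵ₀ := by
    refine (Algebra.IsAlgebraic.cardinalMk_le_max (FractionRing (MvPolynomial ℕ K)) (Om K)).trans ?_
    exact max_le h2 le_rfl
  exact Cardinal.mk_le_aleph0_iff.1 h3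

omit [CharZero K] in
/-- The evaluation `K[X_ℕ] → Ω_K`, `Xᵢ ↦ var i`, is the (injective) canonical map. [folklore] -/
theorem eval₂Hom_var_injective :
    Function.Injective (MvPolynomial.eval₂Hom (emb K) (var K) : MvPolynomial ℕ K →+* Om K) := by
  have : (MvPolynomial.eval₂Hom (emb K) (var K) : MvPolynomial ℕ K →+* Om K) =
      (algebraMap (FractionRing (MvPolynomial ℕ K)) (Om K)).comp
        (algebraMap (MvPolynomial ℕ K) (FractionRing (MvPolynomial ℕ K))) := by
    refine MvPolynomial.ringHom_ext (fun c => ?_) (fun i => ?_)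
    · simp [emb]
    · simp [var]
  rw [this]
  exact toOm_injective K

/-- `ι(K)` as an intermediate field of `Ω_K` over `ℚ`. [folklore] -/
def baseField : IntermediateField ℚ (Om K) := (emb K).toRatAlgHom.fieldRange

/-- The carrier of `baseField` is `range (emb K)`. [folklore] -/
theorem coe_baseField : (baseField K : Set (Om K)) = range (emb K) := by
  rw [baseField, AlgHom.coe_fieldRange]; rfl

/-- The variables are algebraically independent over `ι(K)`. [folklore] -/
theorem algebraicIndependent_var {ι' : Type*} (f : ι' → ℕ) (hf : Function.Injective f) :
    AlgebraicIndependent (baseField K) (var K ∘ f) := by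
  classical
  -- the isomorphism `K ≃ ι(K)`
  have hbij : Function.Bijective ((emb K).rangeRestrictField) :=
    ⟨fun a b h => (emb K).injective (by simpa using congrArg Subtype.val h),
      fun ⟨y, hy⟩ => by obtain ⟨x, rfl⟩ := (emb K).mem_fieldRange.1 hy; exact ⟨x, rfl⟩⟩
  let e : K ≃+* (emb K).fieldRange := RingEquiv.ofBijective _ hbij
  have he : ∀ x : K, ((e x : (emb K).fieldRange) : Om K) = emb K x := fun x => rfl
  -- `baseField K` and `(emb K).fieldRange` have the same carrier; coefficients over `baseField`
  rw [algebraicIndependent_iff]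
  intro p hp
  -- pull the coefficients back to `K`
  have hsurj : ∀ c : baseField K, ∃ x : K, emb K x = c := fun c => by
    have : (c : Om K) ∈ (baseField K : Set (Om K)) := c.2
    rw [coe_baseField] at this
    exact this
  choose pre hpre using hsurj
  let φ : baseField K →+* K :=
    { toFun := pre
      map_one' := (emb K).injective (by rw [hpre, map_one]; rfl)
      map_mul' := fun a b => (emb K).injective (by rw [hpre, map_mul, hpre, hpre]; rfl)
      map_zero' := (emb K).injective (by rw [hpre, map_zero]; rfl)
      map_add' := fun a b => (emb K).injective (by rw [hpre, map_add, hpre, hpre]; rfl) }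
  have hφ : (emb K).comp φ = (algebraMap (baseField K) (Om K)) := by
    ext c; exact hpre c
  have hinjφ : Function.Injective φ := fun a b h => by
    apply Subtype.ext
    have h' : emb K (pre a) = emb K (pre b) := congrArg (emb K) h
    rwa [hpre, hpre] at h'
  -- evaluate: `aeval (var ∘ f) p = eval₂Hom emb var (rename f (map φ p))`
  have key : MvPolynomial.eval₂Hom (emb K) (var K) (rename f (MvPolynomial.map φ p)) =
      aeval (var K ∘ f) p := by
    rw [MvPolynomial.coe_eval₂Hom, eval₂_rename, eval₂_map, hφ]
    rfl
  have h0 : rename f (MvPolynomial.map φ p) = 0 := by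
    apply eval₂Hom_var_injective K
    rw [key, hp, map_zero]
  have h1 : MvPolynomial.map φ p = 0 := rename_injective f hf (by rw [h0, map_zero])
  exact (MvPolynomial.map_injective φ hinjφ) (by rw [h1, map_zero])

omit [CharZero K] in
/-- A variable is not in `ι(K)`. [folklore] -/
theorem var_notMem_range (i : ℕ) : var K i ∉ range (emb K) := by
  classical
  rintro ⟨c, hc⟩
  have h := eval₂Hom_var_injective K (a₁ := MvPolynomial.C c) (a₂ := X i) (by simp [hc, var])
  have := congrArg (MvPolynomial.coeff (Finsupp.single i 1)) h
  rw [MvPolynomial.coeff_C, MvPolynomial.coeff_X,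
    if_neg (Ne.symm (Finsupp.single_ne_zero.2 one_ne_zero)), if_pos rfl] at this
  exact zero_ne_one this

omit [CharZero K] in
/-- `var` is injective. [folklore] -/
theorem var_injective : Function.Injective (var K) := fun i j h => by
  have := eval₂Hom_var_injective K (a₁ := X i) (a₂ := X j) (by simpa [var] using h)
  exact (MvPolynomial.X_injective this)

/-- **Fresh transcendentals**: over `ι(K)` and finitely many elements of `Ω_K` some variable is
transcendental. [folklore] -/
theorem exists_fresh_var (S : Set (Om K)) (hS : S.Finite) :
    ∃ i, var K i ∉ acl (S ∪ range (emb K)) := by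
  classical
  by_contra hall
  simp only [not_exists, not_not] at hall
  set n := hS.toFinset.card with hn
  -- `var '' {0, …, n}` is independent in the contraction by `ι(K)`
  have hind : AlgebraicIndepOn (baseField K) id (var K '' (↑(Finset.range (n + 1)) : Set ℕ)) := by
    let eqv := Equiv.Set.image (var K) (↑(Finset.range (n + 1)) : Set ℕ) (var_injective K)
    have h := algebraicIndependent_var K
      (((↑) : (↑(Finset.range (n + 1)) : Set ℕ) → ℕ) ∘ eqv.symm)
      (Subtype.val_injective.comp eqv.symm.injective)
    change AlgebraicIndependent (baseField K)
      (fun x : (var K '' (↑(Finset.range (n + 1)) : Set ℕ)) => id (x : Om K))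
    convert h using 1
    ext y
    obtain ⟨x, rfl⟩ := eqv.surjective y
    simp only [Function.comp_apply, Equiv.symm_apply_apply, id_eq]
    rfl
  have hcontr := GammaField.contract_indep_of_algebraicIndepOn (baseField K) hind
  rw [coe_baseField] at hcontr
  -- but it lies in the closure of `S` in the contraction
  have hIcl : var K '' (↑(Finset.range (n + 1)) : Set ℕ) ⊆
      ((algMatroid (Om K)).contract (range (emb K))).closure S := by
    rw [Matroid.contract_closure_eq]
    rintro _ ⟨i, hi, rfl⟩
    exact ⟨hall i, var_notMem_range K i⟩
  have h1 : (var K '' (↑(Finset.range (n + 1)) : Set ℕ)).encard ≤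
      ((algMatroid (Om K)).contract (range (emb K))).eRk S :=
    (hcontr.encard_le_eRk_of_subset hIcl).trans (by rw [Matroid.eRk_closure_eq])
  have h2 : ((algMatroid (Om K)).contract (range (emb K))).eRk S ≤ S.encard :=
    Matroid.eRk_le_encard _ _
  have h3 : S.encard = n := by
    rw [hn, ← Set.encard_coe_eq_coe_finsetCard, hS.coe_toFinset]
  have h4 : (var K '' (↑(Finset.range (n + 1)) : Set ℕ)).encard = n + 1 := by
    rw [(var_injective K).injOn.encard_image, Set.encard_coe_eq_coe_finsetCard, Finset.card_range]
    push_cast; rfl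
  have := (h4 ▸ h1).trans (h3 ▸ h2)
  exact absurd this (by
    rw [not_le]
    exact_mod_cast Nat.lt_succ_self n)

end Ambient

/-! ### Algebraically closed intermediate fields `acl C` -/

section AclField

variable {Ω : Type*} [Field Ω] [CharZero Ω]

/-- `acl C` as an intermediate field over `ℚ`. We build it from `GammaField.exists_subalgebra_eq_acl`
(rather than `GammaField.exists_intermediateField_eq_acl`) because that existence statement also
records that elements algebraic over the subalgebra lie in `acl C`, which gives algebraic
closedness below (`isAlgClosed_aclField`). [folklore] -/
def aclField (C : Set Ω) : IntermediateField ℚ Ω :=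
  (exists_subalgebra_eq_acl C).choose.toIntermediateField fun x hx => by
    have h := (exists_subalgebra_eq_acl C).choose_spec.1
    rw [← SetLike.mem_coe, h] at hx ⊢
    exact inv_mem_acl hx

/-- The carrier of `aclField C` is `acl C`. [folklore] -/
@[simp] theorem coe_aclField (C : Set Ω) : (aclField C : Set Ω) = acl C :=
  (exists_subalgebra_eq_acl C).choose_spec.1

/-- Membership in `aclField C`. [folklore] -/
theorem mem_aclField_iff {C : Set Ω} {x : Ω} : x ∈ aclField C ↔ x ∈ acl C := by
  rw [← SetLike.mem_coe, coe_aclField]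

/-- Elements algebraic over `aclField C` lie in `acl C`. [folklore] -/
theorem mem_acl_of_isAlgebraic {C : Set Ω} {x : Ω} (hx : IsAlgebraic (aclField C) x) : x ∈ acl C := by
  refine (exists_subalgebra_eq_acl C).choose_spec.2 x ?_
  obtain ⟨p, hp0, hp⟩ := hx
  exact ⟨p, hp0, hp⟩

/-- `aclField C` is algebraically closed when `Ω` is. [folklore] -/
theorem isAlgClosed_aclField [IsAlgClosed Ω] (C : Set Ω) : IsAlgClosed (aclField C) := by
  refine IsAlgClosed.of_exists_root _ fun p hmonic hirr => ?_
  have hdeg : p.degree ≠ 0 := by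
    intro h
    exact hirr.not_isUnit (Polynomial.isUnit_iff_degree_eq_zero.2 h) |>.elim
  -- a root in `Ω`
  obtain ⟨r, hr0⟩ := IsAlgClosed.exists_root (p.map (algebraMap (aclField C) Ω))
    (by rwa [Polynomial.degree_map])
  have hr : Polynomial.aeval r p = 0 := by
    rwa [Polynomial.IsRoot.def, Polynomial.eval_map, ← Polynomial.aeval_def] at hr0
  have hralg : IsAlgebraic (aclField C) r := ⟨p, hmonic.ne_zero, hr⟩
  have hrmem : r ∈ aclField C := mem_aclField_iff.2 (mem_acl_of_isAlgebraic hralg)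
  have key : algebraMap (aclField C) Ω (Polynomial.aeval (⟨r, hrmem⟩ : aclField C) p) =
      Polynomial.aeval r p := by
    rw [← Polynomial.aeval_algebraMap_apply]; rfl
  have h0 : Polynomial.aeval (⟨r, hrmem⟩ : aclField C) p = 0 := by
    apply (algebraMap (aclField C) Ω).injective
    rw [key, hr, map_zero]
  refine ⟨⟨r, hrmem⟩, ?_⟩
  change Polynomial.eval _ p = 0
  rw [← Polynomial.coe_aeval_eq_eval]
  exact h0

end AclField

/-! ### The schedule and the chain of stages -/

section Chain

variable {K : Type u} [Field K] [CharZero K] {D : Submodule ℚ K} {θ : K → K} {τ : K}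

/-- Fresh transcendentals in `Ω_K`, in the form used by the steps. [folklore] -/
theorem fresh_om (S : Set (Om K)) (hS : S.Finite) : ∃ w, w ∉ acl (S ∪ range (emb K)) :=
  let ⟨i, hi⟩ := exists_fresh_var K S hS
  ⟨var K i, hi⟩

/-- `K = ℚ(D ∪ θ(D))` with `D` finite-dimensional is countable. [folklore] -/
theorem countable_of_isStdKernel (hK : IsStdKernelPartialExpField K D θ τ) : Countable K := by
  haveI := hK.finiteDimensional
  -- `D` is countable
  have hD : (D : Set K).Countable := by
    let b := Module.finBasis ℚ D
    have hinj : Function.Injective fun x : D => (b.repr x : Fin (Module.finrank ℚ D) → ℚ) :=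
      fun x y h => b.repr.injective (DFunLike.coe_injective h)
    haveI : Countable D := hinj.countable
    exact Set.countable_coe_iff.1 inferInstance
  have hs : ((D : Set K) ∪ θ '' D).Countable := hD.union (hD.image θ)
  have hcl : #(Subfield.closure ((D : Set K) ∪ θ '' D)) ≤ ℵ₀ :=
    (Subfield.cardinalMk_closure_le_max _).trans
      (max_le (Cardinal.mk_le_aleph0_iff.2 hs.to_subtype) le_rfl)
  rw [hK.closure_eq_top] at hcl
  have : #K ≤ ℵ₀ := by
    rw [← Cardinal.mk_congr Subfield.topEquiv.toEquiv]; exact hcl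
  exact Cardinal.mk_le_aleph0_iff.1 this

variable (K) in
/-- The enumerations driving the schedule: all elements of `Ω_K` and all finite systems of
polynomial equations in `2n` variables over `Ω_K`, `n ∈ ℕ`. [folklore] -/
structure Sched where
  /-- an enumeration of `Ω_K` -/
  enumΩ : ℕ → Om K
  /-- … which is surjective -/
  enumΩ_surjective : Function.Surjective enumΩ
  /-- an enumeration of the finite systems of equations -/
  item : ℕ → Σ n : ℕ, Finset (MvPolynomial (Fin n ⊕ Fin n) (Om K))
  /-- … which is surjective -/
  item_surjective : Function.Surjective item

/-- Schedules exist (everything is countable). [folklore] -/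
theorem nonempty_sched (hK : IsStdKernelPartialExpField K D θ τ) : Nonempty (Sched K) := by
  haveI : Countable K := countable_of_isStdKernel hK
  haveI : Countable (Om K) := countable_om K
  haveI : ∀ n : ℕ, Countable (MvPolynomial (Fin n ⊕ Fin n) (Om K)) := fun n => by
    have h : #(MvPolynomial (Fin n ⊕ Fin n) (Om K)) ≤ ℵ₀ := by
      refine (MvPolynomial.cardinalMk_le_max_lift (σ := Fin n ⊕ Fin n) (R := Om K)).trans ?_
      refine sup_le (sup_le ?_ ?_) le_rfl
      · exact Cardinal.lift_le_aleph0.2 Cardinal.mk_le_aleph0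
      · exact Cardinal.lift_le_aleph0.2 Cardinal.mk_le_aleph0
    exact Cardinal.mk_le_aleph0_iff.1 h
  obtain ⟨f, hf⟩ := exists_surjective_nat (Om K)
  obtain ⟨g, hg⟩ := exists_surjective_nat (Σ n : ℕ, Finset (MvPolynomial (Fin n ⊕ Fin n) (Om K)))
  exact ⟨⟨f, hf, g, hg⟩⟩

/-- The Γ-field generators of a stage. [folklore] -/
abbrev State.gens' (σ : State (emb K) D θ τ) : Set (Om K) := @GammaField.gens _ _ _ σ.E.inst σ.Λ

/-- The algebraically closed field `acl (Λ ∪ E Λ)` of a stage. [folklore] -/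
abbrev State.fld (σ : State (emb K) D θ τ) : IntermediateField ℚ (Om K) := aclField σ.gens'

/-- **Admissible points for the point-adjunction task** `(n, G)` at the stage `σ`: `yⱼ ≠ 0`, the
freeness and rotundity hypotheses of `State.exists_step_point`, and genericity over the field of
the stage for the ideal of `W = Z(G)`. [cite: BaysKirby2018ANT, Lemma 8.3] -/
def Admissible (σ : State (emb K) D θ τ) (n : ℕ) (G : Finset (MvPolynomial (Fin n ⊕ Fin n) (Om K)))
    (x y : Fin n → Om K) : Prop :=
  (∀ j, y j ≠ 0) ∧
  (∀ q : Fin n → ℚ, (∑ j, q j • x j) ∈ acl σ.gens' → q = 0) ∧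
  (∀ m : Fin n → ℤ, (∏ j, y j ^ m j) ∈ acl σ.gens' → m = 0) ∧
  (∀ M : Matrix (Fin n) (Fin n) ℤ, ((M.map (Int.cast : ℤ → ℚ)).rank : ℕ∞) ≤
    (algMatroid (Om K)).relRank (acl σ.gens') (range (matrixAct M (Sum.elim x y)))) ∧
  (∀ p : MvPolynomial (Fin n ⊕ Fin n) σ.fld, aeval (Sum.elim x y) p = 0 ↔
    p ∈ vanishingIdeal σ.fld (zeroLocus (Om K) (Ideal.span (↑G : Set (MvPolynomial _ (Om K))))))

variable (hK : IsStdKernelPartialExpField K D θ τ) (sch : Sched K)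
include hK

open scoped Classical in
/-- **One step of the schedule**, with its strongness certificate. At time `t = ⟨k, c⟩`:
`c ≡ 0 (mod 4)`: put `enumΩ k` into the domain; `c ≡ 1`: make `enumΩ k` a value (if non-zero);
`c ≡ 2`: adjoin a generic point of `G¹`; `c ≡ 3`: adjoin an admissible point for the task
`item k`, if there is one. [cite: BaysKirby2018ANT, Thm 5.9 (proof)] -/
def nextS (t : ℕ) (σ : State (emb K) D θ τ) : {σ' : State (emb K) D θ τ // Step σ σ'} :=
  if (Nat.unpair t).2 % 4 = 0 then
    ⟨(σ.exists_step_exp hK fresh_om (sch.enumΩ (Nat.unpair t).1)).choose,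
      (σ.exists_step_exp hK fresh_om (sch.enumΩ (Nat.unpair t).1)).choose_spec.1⟩
  else if (Nat.unpair t).2 % 4 = 1 then
    (if h : sch.enumΩ (Nat.unpair t).1 ≠ 0 then
      ⟨(σ.exists_step_log hK fresh_om h).choose, (σ.exists_step_log hK fresh_om h).choose_spec.1⟩
     else ⟨σ, Step.refl σ⟩)
  else if (Nat.unpair t).2 % 4 = 2 then
    ⟨(σ.exists_step_generic hK fresh_om).choose,
      (σ.exists_step_generic hK fresh_om).choose_spec.choose_spec.1⟩
  else if h : ∃ xy : (Fin (sch.item (Nat.unpair t).1).1 → Om K) × (Fin (sch.item (Nat.unpair t).1).1 → Om K),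
      Admissible σ _ (sch.item (Nat.unpair t).1).2 xy.1 xy.2 then
    ⟨(σ.exists_step_point hK h.choose_spec.1 h.choose_spec.2.1 h.choose_spec.2.2.1
      h.choose_spec.2.2.2.1).choose,
     (σ.exists_step_point hK h.choose_spec.1 h.choose_spec.2.1 h.choose_spec.2.2.1
      h.choose_spec.2.2.2.1).choose_spec.1⟩
  else ⟨σ, Step.refl σ⟩

/-- One step of the schedule. [cite: BaysKirby2018ANT, Thm 5.9 (proof)] -/
def next (t : ℕ) (σ : State (emb K) D θ τ) : State (emb K) D θ τ := (nextS hK sch t σ).1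

/-- Every scheduled step is a strong extension. [folklore] -/
theorem step_next (t : ℕ) (σ : State (emb K) D θ τ) : Step σ (next hK sch t σ) := (nextS hK sch t σ).2

/-- **The chain of stages.** [cite: BaysKirby2018ANT, Thm 5.9 (proof)] -/
def chain : ℕ → State (emb K) D θ τ
  | 0 => (State.exists_init (ι := emb K) hK).choose
  | t + 1 => next hK sch t (chain t)

/-- The initial domain is the base `ι(D)`. [folklore] -/
theorem chain_zero_Λ : (chain hK sch 0).Λ = baseSub (emb K) D :=
  (State.exists_init (ι := emb K) hK).choose_spec

/-- Consecutive stages. [folklore] -/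
theorem chain_succ (t : ℕ) : chain hK sch (t + 1) = next hK sch t (chain hK sch t) := rfl

/-- The chain is increasing for `Step`. [folklore] -/
theorem chain_mono {s t : ℕ} (h : s ≤ t) : Step (chain hK sch s) (chain hK sch t) := by
  induction h with
  | refl => exact Step.refl _
  | step _ ih => exact ih.trans (step_next hK sch _ _)

end Chain

/-! ### What the schedule achieves -/

section Schedule

variable {K : Type u} [Field K] [CharZero K] {D : Submodule ℚ K} {θ : K → K} {τ : K}
variable (hK : IsStdKernelPartialExpField K D θ τ) (sch : Sched K)
include hK

open scoped Classical in
/-- The step at a time `≡ 0 (mod 4)`. [folklore] -/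
theorem next_of_mod_zero {t : ℕ} (σ : State (emb K) D θ τ) (h : (Nat.unpair t).2 % 4 = 0) :
    next hK sch t σ = (σ.exists_step_exp hK fresh_om (sch.enumΩ (Nat.unpair t).1)).choose := by
  simp [next, nextS, h]

open scoped Classical in
/-- The step at a time `≡ 1 (mod 4)`. [folklore] -/
theorem next_of_mod_one {t : ℕ} (σ : State (emb K) D θ τ) (h : (Nat.unpair t).2 % 4 = 1)
    (hb : sch.enumΩ (Nat.unpair t).1 ≠ 0) :
    next hK sch t σ = (σ.exists_step_log hK fresh_om hb).choose := by
  simp [next, nextS, h, hb]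

open scoped Classical in
/-- The step at a time `≡ 2 (mod 4)`. [folklore] -/
theorem next_of_mod_two {t : ℕ} (σ : State (emb K) D θ τ) (h : (Nat.unpair t).2 % 4 = 2) :
    next hK sch t σ = (σ.exists_step_generic hK fresh_om).choose := by
  simp [next, nextS, h]

open scoped Classical in
/-- The step at a time `≡ 3 (mod 4)` when an admissible point exists. [folklore] -/
theorem next_of_mod_three {t : ℕ} (σ : State (emb K) D θ τ) (h : (Nat.unpair t).2 % 4 = 3)
    (hex : ∃ xy : (Fin (sch.item (Nat.unpair t).1).1 → Om K) × (Fin (sch.item (Nat.unpair t).1).1 → Om K),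
      Admissible σ _ (sch.item (Nat.unpair t).1).2 xy.1 xy.2) :
    next hK sch t σ = (σ.exists_step_point hK hex.choose_spec.1 hex.choose_spec.2.1
      hex.choose_spec.2.2.1 hex.choose_spec.2.2.2.1).choose := by
  simp only [next, nextS, h]
  rw [dif_pos hex]
  simp

/-- **Every element enters the domain.** [cite: BaysKirby2018ANT, Thm 5.9 (fullness)] -/
theorem exists_mem_Λ (ω : Om K) : ∃ t, ω ∈ (chain hK sch t).Λ := by
  obtain ⟨k, hk⟩ := sch.enumΩ_surjective ω
  refine ⟨Nat.pair k 0 + 1, ?_⟩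
  rw [chain_succ, next_of_mod_zero hK sch _ (by simp [Nat.unpair_pair])]
  have := ((chain hK sch (Nat.pair k 0)).exists_step_exp hK fresh_om
    (sch.enumΩ (Nat.unpair (Nat.pair k 0)).1)).choose_spec.2
  simpa [Nat.unpair_pair, hk] using this

/-- **Every non-zero element becomes a value.** [cite: BaysKirby2018ANT, Thm 5.9 (fullness)] -/
theorem exists_mem_image {b : Om K} (hb : b ≠ 0) :
    ∃ t, b ∈ (chain hK sch t).E '' (chain hK sch t).Λ := by
  obtain ⟨k, hk⟩ := sch.enumΩ_surjective b
  have hb' : sch.enumΩ (Nat.unpair (Nat.pair k 1)).1 ≠ 0 := by simpa [Nat.unpair_pair, hk] using hb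
  refine ⟨Nat.pair k 1 + 1, ?_⟩
  rw [chain_succ, next_of_mod_one hK sch _ (by simp [Nat.unpair_pair]) hb']
  have := ((chain hK sch (Nat.pair k 1)).exists_step_log hK fresh_om hb').choose_spec.2
  simpa [Nat.unpair_pair, hk] using this

/-- **Generic points of `G¹` are adjoined at all times `⟨k, 2⟩`.**
[cite: BaysKirby2018ANT, Thm 6.9 (proof of QM2)] -/
theorem exists_generic (k : ℕ) :
    ∃ a, (chain hK sch (Nat.pair k 2 + 1)).Λ = (chain hK sch (Nat.pair k 2)).Λ ⊔ Submodule.span ℚ {a} ∧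
      a ∉ acl (chain hK sch (Nat.pair k 2)).gens' ∧
      (chain hK sch (Nat.pair k 2 + 1)).E a ∉ acl ((chain hK sch (Nat.pair k 2)).gens' ∪ {a}) := by
  rw [chain_succ, next_of_mod_two hK sch _ (by simp [Nat.unpair_pair])]
  obtain ⟨a, -, hΛ, ha, hEa⟩ := ((chain hK sch (Nat.pair k 2)).exists_step_generic hK fresh_om).choose_spec
  exact ⟨a, hΛ, ha, hEa⟩

/-- **Admissible points for the task `item k` are adjoined at all times `t = ⟨k, c⟩`,
`c ≡ 3 (mod 4)`** at which one exists. [cite: BaysKirby2018ANT, Lemma 8.3] -/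
theorem exists_point {t k : ℕ} (hk : (Nat.unpair t).1 = k) (h3 : (Nat.unpair t).2 % 4 = 3)
    (hex : ∃ xy : (Fin (sch.item k).1 → Om K) × (Fin (sch.item k).1 → Om K),
      Admissible (chain hK sch t) _ (sch.item k).2 xy.1 xy.2) :
    ∃ x y : Fin (sch.item k).1 → Om K,
      Admissible (chain hK sch t) _ (sch.item k).2 x y ∧
      (∀ j, x j ∈ (chain hK sch (t + 1)).Λ) ∧
      ∀ j, (chain hK sch (t + 1)).E (x j) = y j := by
  subst hk
  rw [chain_succ, next_of_mod_three hK sch _ h3 hex]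
  have hsp := ((chain hK sch t).exists_step_point hK hex.choose_spec.1 hex.choose_spec.2.1
      hex.choose_spec.2.2.1 hex.choose_spec.2.2.2.1).choose_spec
  refine ⟨hex.choose.1, hex.choose.2, hex.choose_spec, fun j => ?_, hsp.2.2⟩
  rw [hsp.2.1]
  exact Submodule.mem_sup_right (Submodule.subset_span ⟨j, rfl⟩)

omit [Field K] [CharZero K] hK in
/-- Times `⟨k, 4m + 3⟩` serve the task `item k`. [folklore] -/
theorem unpair_pair_task (k m : ℕ) :
    (Nat.unpair (Nat.pair k (4 * m + 3))).1 = k ∧ (Nat.unpair (Nat.pair k (4 * m + 3))).2 % 4 = 3 := by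
  simp [Nat.unpair_pair]

omit [Field K] [CharZero K] hK in
/-- Such times are unbounded. [folklore] -/
theorem le_pair_task (k m : ℕ) : m ≤ Nat.pair k (4 * m + 3) :=
  le_trans (by omega) (Nat.right_le_pair k (4 * m + 3))

end Schedule

/-! ### The limit exponential map -/

section LimitExp

variable {K : Type u} [Field K] [CharZero K] {D : Submodule ℚ K} {θ : K → K} {τ : K}
variable (hK : IsStdKernelPartialExpField K D θ τ) (sch : Sched K)
include hK

open scoped Classical in
/-- The first stage whose domain contains `ω`. [folklore] -/
def stage (ω : Om K) : ℕ := Nat.find (exists_mem_Λ hK sch ω)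

open scoped Classical in
/-- `ω` lies in the domain at its stage. [folklore] -/
theorem mem_Λ_stage (ω : Om K) : ω ∈ (chain hK sch (stage hK sch ω)).Λ :=
  Nat.find_spec (exists_mem_Λ hK sch ω)

/-- **The limit exponential map** `E_∞ ω = E_t ω` for any stage `t` containing `ω`.
[cite: BaysKirby2018ANT, Thm 5.9] -/
def Einf (ω : Om K) : Om K := (chain hK sch (stage hK sch ω)).E ω

/-- `E_∞` agrees with `E_t` on `Λ_t`. [folklore] -/
theorem Einf_eq {ω : Om K} {t : ℕ} (h : ω ∈ (chain hK sch t).Λ) : Einf hK sch ω = (chain hK sch t).E ω := by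
  unfold Einf
  rcases le_total (stage hK sch ω) t with hle | hle
  · exact ((chain_mono hK sch hle).eqOn ω (mem_Λ_stage hK sch ω)).symm
  · exact (chain_mono hK sch hle).eqOn ω h

/-- Domains along the chain are monotone. [folklore] -/
theorem Λ_mono {s t : ℕ} (h : s ≤ t) : (chain hK sch s).Λ ≤ (chain hK sch t).Λ := (chain_mono hK sch h).le

/-- A common stage for two elements. [folklore] -/
theorem exists_common_stage (a b : Om K) : ∃ t, a ∈ (chain hK sch t).Λ ∧ b ∈ (chain hK sch t).Λ :=
  ⟨max (stage hK sch a) (stage hK sch b), Λ_mono hK sch (le_max_left _ _) (mem_Λ_stage hK sch a),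
    Λ_mono hK sch (le_max_right _ _) (mem_Λ_stage hK sch b)⟩

/-- A common stage for a finite set. [folklore] -/
theorem exists_stage_of_finite {S : Set (Om K)} (hS : S.Finite) : ∃ t, S ⊆ (chain hK sch t).Λ := by
  induction S, hS using Set.Finite.induction_on with
  | empty => exact ⟨0, empty_subset _⟩
  | insert _ _ ih =>
    obtain ⟨t, ht⟩ := ih
    rename_i a s _ _
    refine ⟨max t (stage hK sch a), insert_subset (Λ_mono hK sch (le_max_right _ _) (mem_Λ_stage hK sch a))
      (ht.trans (Λ_mono hK sch (le_max_left _ _)))⟩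

/-- **The limit exponential map as an `EHom`.** [cite: BaysKirby2018ANT, Thm 5.9] -/
def Elim : EHom (Om K) where
  toFun := Einf hK sch
  map_zero_eq_one' := by
    rw [Einf_eq hK sch (t := 0) (Submodule.zero_mem _)]; exact (chain hK sch 0).E.map_zero_eq_one
  map_add_eq_mul' a b := by
    obtain ⟨t, ha, hb⟩ := exists_common_stage hK sch a b
    rw [Einf_eq hK sch (Submodule.add_mem _ ha hb), Einf_eq hK sch ha, Einf_eq hK sch hb]
    exact (chain hK sch t).E.map_add_eq_mul a b

/-- `E_lim` agrees with `E_t` on `Λ_t`. [folklore] -/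
theorem Elim_eq {ω : Om K} {t : ℕ} (h : ω ∈ (chain hK sch t).Λ) : Elim hK sch ω = (chain hK sch t).E ω :=
  Einf_eq hK sch h

/-- **The model**: `Ω_K` with the limit exponential map. [cite: BaysKirby2018ANT, Thm 5.9] -/
abbrev instModel : ExponentialRing (Om K) := (Elim hK sch).inst

end LimitExp

/-! ### Properties of the limit model, I: fullness, kernel, base, strongness -/

section Props

variable {K : Type u} [Field K] [CharZero K] {D : Submodule ℚ K} {θ : K → K} {τ : K}
variable (hK : IsStdKernelPartialExpField K D θ τ) (sch : Sched K)
include hK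

/-- `exp = E_t` on `Λ_t`. [folklore] -/
theorem exp_eq {ω : Om K} {t : ℕ} (h : ω ∈ (chain hK sch t).Λ) :
    @ExponentialRing.exp (Om K) _ (instModel hK sch) ω = (chain hK sch t).E ω :=
  Elim_eq hK sch h

/-- **Fullness: the exponential map of the model is surjective onto the units.**
[cite: BaysKirby2018ANT, Thm 5.9] -/
theorem isSurjectiveOntoUnits : @IsSurjectiveOntoUnits (Om K) _ (instModel hK sch) := by
  intro b hb
  obtain ⟨t, a, ha, hab⟩ := exists_mem_image hK sch hb
  exact ⟨a, by rw [exp_eq hK sch ha]; exact hab⟩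

/-- **The kernel of the model is standard**: `ι(τ)ℤ`. [cite: BaysKirby2018ANT, Thm 5.9 (kernel-preserving)] -/
theorem expKernel_eq :
    @expKernel (Om K) _ (instModel hK sch) = AddSubgroup.zmultiples (emb K τ) := by
  ext ω
  rw [@mem_expKernel_iff (Om K) _ (instModel hK sch), exp_eq hK sch (mem_Λ_stage hK sch ω)]
  exact (chain hK sch _).ker ω (mem_Λ_stage hK sch ω)

/-- **The model extends the base**: `exp (ι x) = ι (θ x)` on `D`. [cite: BaysKirby2018ANT, Thm 5.9] -/
theorem exp_emb {x : K} (hx : x ∈ D) :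
    @ExponentialRing.exp (Om K) _ (instModel hK sch) (emb K x) = emb K (θ x) := by
  have hmem : emb K x ∈ (chain hK sch 0).Λ := by
    rw [chain_zero_Λ]; exact mem_baseSub_iff.2 ⟨x, hx, rfl⟩
  rw [exp_eq hK sch hmem]
  exact (chain hK sch 0).base_exp x hx

/-- A subspace finitely generated over some `Λ_s` lies in some `Λ_t`, `t ≥ s`. [folklore] -/
theorem exists_le_Λ {s : ℕ} {Λ' : Submodule ℚ (Om K)} (hfg : IsFG (chain hK sch s).Λ Λ') :
    ∃ t, s ≤ t ∧ Λ' ≤ (chain hK sch t).Λ := by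
  classical
  obtain ⟨S, -, hle⟩ := isFG_iff_exists_finset.1 hfg
  obtain ⟨t, ht⟩ := exists_stage_of_finite hK sch S.finite_toSet
  refine ⟨max s t, le_max_left _ _, hle.trans (sup_le (Λ_mono hK sch (le_max_left _ _)) ?_)⟩
  exact Submodule.span_le.2 (ht.trans (Λ_mono hK sch (le_max_right _ _)))

/-- The Γ-field generators of `Λ_t` in the model are those of the stage. [folklore] -/
theorem gens_chain (t : ℕ) :
    @GammaField.gens (Om K) _ _ (instModel hK sch) (chain hK sch t).Λ = (chain hK sch t).gens' :=
  gens_congr (E := Elim hK sch) (E' := (chain hK sch t).E) fun _ hω => Elim_eq hK sch hω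

/-- The predimension over `Λ_t` of a subspace of `Λ_s` in the model is the stage's. [folklore] -/
theorem predim_chain {t s : ℕ} (hts : t ≤ s) {Λ' : Submodule ℚ (Om K)} (h : Λ' ≤ (chain hK sch s).Λ) :
    @GammaField.predim (Om K) _ _ (instModel hK sch) (chain hK sch t).Λ Λ' =
      δ (chain hK sch s).E (chain hK sch t).Λ Λ' := by
  change δ (Elim hK sch) (chain hK sch t).Λ Λ' = _
  refine δ_congr (fun ω hω => ?_) (fun ω hω => ?_)
  · rw [Elim_eq hK sch hω]; exact ((chain_mono hK sch hts).eqOn ω hω).symm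
  · exact Elim_eq hK sch (h hω)

/-- **Every stage is strong in the model**: `Λ_t ◁ Ω`. [cite: BaysKirby2018ANT, Thm 5.9 and Lemma 4.4] -/
theorem isStrong_chain (t : ℕ) : @GammaField.IsStrong (Om K) _ _ (instModel hK sch) (chain hK sch t).Λ := by
  letI := instModel hK sch
  intro Λ' hle hfg
  obtain ⟨s, hts, hΛ's⟩ := exists_le_Λ hK sch hfg
  rw [predim_chain hK sch hts hΛ's]
  exact (chain_mono hK sch hts).strong hle hΛ's hfg

/-- **The base is strong in the model**: `ι(D) ◁ Ω`. [cite: BaysKirby2018ANT, Thm 5.9] -/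
theorem isStrong_base :
    @GammaField.IsStrong (Om K) _ _ (instModel hK sch) (Submodule.span ℚ (emb K '' (D : Set K))) := by
  rw [span_image_eq_baseSub, ← chain_zero_Λ hK sch]
  exact isStrong_chain hK sch 0

/-! ### Properties of the limit model, II: infinite dimension -/

omit hK in
/-- `td(a, E a / gens) = 2` for the generic step. [folklore] -/
theorem relRank_pair_eq_two {C : Set (Om K)} {a b : Om K} (ha : a ∉ acl C) (hb : b ∉ acl (C ∪ {a})) :
    (algMatroid (Om K)).relRank C {a, b} = 2 := by
  have h1 : (algMatroid (Om K)).relRank C {a} = 1 := relRank_singleton_eq_one ha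
  have h2 := (algMatroid (Om K)).relRank_insert_eq_add_one (C := C) (X := {a}) (e := b) (by simp)
    (by rw [singleton_union, ← union_singleton]; exact hb)
  rw [h1] at h2
  rw [pair_comm]
  exact h2.trans (by norm_num)

/-- **The model is infinite dimensional**: over every finite set some element is not
exponentially algebraic (the generic points of `G¹` adjoined cofinally have dimension one over
the strong stage below them; Kirby 2010 Thm 1.3 bounds `ecl` by predimension zero).
[cite: BaysKirby2018ANT, Thm 6.9 (proof of QM2)] [cite: Kirby2010, Thm. 1.3] -/
theorem exists_notMem_ecl (C : Set (Om K)) (hC : C.Finite) :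
    ∃ d, d ∉ @ecl (Om K) _ (instModel hK sch) C := by
  letI := instModel hK sch
  obtain ⟨t, ht⟩ := exists_stage_of_finite hK sch hC
  set T := Nat.pair t 2 with hT
  obtain ⟨a, hΛ, ha, hEa⟩ := exists_generic hK sch t
  refine ⟨a, fun hmem => ?_⟩
  -- `a ∈ ecl C ⊆ ecl Λ_T`
  have hCT : C ⊆ ((chain hK sch T).Λ : Set (Om K)) := ht.trans (Λ_mono hK sch (Nat.left_le_pair t 2))
  have hmem' : a ∈ ecl ((chain hK sch T).Λ : Set (Om K)) := ecl_mono hCT hmem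
  obtain ⟨E, hE, hfgE, hδ⟩ :=
    GammaField.exists_predim_eq_zero_of_mem_ecl_of_isStrong (isStrong_chain hK sch T) hmem'
  -- `δ(E/Λ_T) = δ(Λ_{T+1}/Λ_T) + δ(E/Λ_{T+1}) ≥ 1 + 0`
  have hle1 : (chain hK sch T).Λ ≤ (chain hK sch (T + 1)).Λ := Λ_mono hK sch (Nat.le_succ T)
  have hle2 : (chain hK sch (T + 1)).Λ ≤ E := by rw [hΛ]; exact hE
  have hadd := predim_add hle1 hle2 hfgE
  have hstrong : 0 ≤ predim (chain hK sch (T + 1)).Λ E :=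
    isStrong_chain hK sch (T + 1) hle2 (hfgE.of_le_left hle1)
  have hone : predim (chain hK sch T).Λ (chain hK sch (T + 1)).Λ = 1 := by
    rw [hΛ, predim_sup_left, predim_def, td_span_singleton, gens_chain,
      exp_eq hK sch (t := T + 1) (by rw [hΛ]; exact Submodule.mem_sup_right (Submodule.mem_span_singleton_self a)),
      relRank_pair_eq_two ha hEa]
    have hldim : ldim (chain hK sch T).Λ (Submodule.span ℚ {a}) = 1 := by
      refine le_antisymm (ldim_span_singleton_le _ _) ?_
      have hfg1 : IsFG (chain hK sch T).Λ (Submodule.span ℚ {a}) := isFG_span_of_finite _ (finite_singleton a)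
      have : 0 < ldim (chain hK sch T).Λ (Submodule.span ℚ {a}) := by
        rw [ldim_pos_iff hfg1, Submodule.span_singleton_le_iff_mem]
        exact fun h => ha (subset_acl _ (@GammaField.mem_gens_of_mem _ _ _ (chain hK sch T).E.inst _ _ h))
      omega
    rw [hldim]
    norm_num
  omega

end Props

/-! ### Properties of the limit model, III: admissibility of generic points -/

section AdmissibleGeneric

variable {Ω : Type u} [Field Ω] [CharZero Ω] [IsAlgClosed Ω]

omit [IsAlgClosed Ω] in
/-- The contraction of `I_Ω(W)` to `L[X]` is `I_L(W)`. [folklore] -/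
theorem contract_vanishingIdeal_eq (L : IntermediateField ℚ Ω) {ι' : Type*} (W : Set (ι' → Ω)) :
    ChartTransfer.contract (M := L) (vanishingIdeal Ω W) = vanishingIdeal L W := by
  ext q
  rw [ChartTransfer.mem_contract_iff, mem_vanishingIdeal_iff, mem_vanishingIdeal_iff]
  refine forall₂_congr fun x _ => ?_
  rw [aeval_map_algebraMap]

omit [CharZero Ω] [IsAlgClosed Ω] in
/-- A closed set is cut out by finitely many polynomials. [folklore] -/
theorem exists_finset_eq_zeroLocus {ι' : Type*} [Finite ι'] {W : Set (ι' → Ω)} (hW : IsZariskiClosed Ω W) :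
    ∃ G : Finset (MvPolynomial ι' Ω), W = zeroLocus Ω (Ideal.span (↑G : Set (MvPolynomial ι' Ω))) := by
  obtain ⟨I, rfl⟩ := hW
  obtain ⟨s, rfl⟩ := (inferInstance : IsNoetherianRing (MvPolynomial ι' Ω)).noetherian I
  exact ⟨s, rfl⟩

omit [IsAlgClosed Ω] in
/-- Polynomials with coefficients in `L` come from `L[X]`, so `W = Z(G)` is the zero locus of the
ideal of `L[X]` generated by the preimage of `G`. [folklore] -/
theorem eq_zeroLocus_span_preimage (L : IntermediateField ℚ Ω) {ι' : Type*} {W : Set (ι' → Ω)}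
    {G : Finset (MvPolynomial ι' Ω)} (hWG : W = zeroLocus Ω (Ideal.span (↑G : Set (MvPolynomial ι' Ω))))
    (hcoef : ∀ g ∈ G, (↑g.coeffs : Set Ω) ⊆ (L : Set Ω)) :
    W = zeroLocus Ω (Ideal.span
      (MvPolynomial.map (algebraMap L Ω) ⁻¹' (↑G : Set (MvPolynomial ι' Ω)))) := by
  have hlift : ∀ g ∈ G, ∃ q : MvPolynomial ι' L, MvPolynomial.map (algebraMap L Ω) q = g := by
    intro g hg
    have : g ∈ Set.range (MvPolynomial.map (algebraMap L Ω)) := by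
      rw [mem_range_map_iff_coeffs_subset]
      intro c hc
      exact ⟨⟨c, hcoef g hg hc⟩, rfl⟩
    exact this
  rw [hWG]
  ext x
  rw [zeroLocus_span, zeroLocus_span]
  simp only [mem_setOf_eq, mem_preimage, Finset.mem_coe]
  constructor
  · intro h q hq
    rw [← aeval_map_algebraMap Ω, h _ hq]
  · intro h g hg
    obtain ⟨q, rfl⟩ := hlift g hg
    rw [aeval_map_algebraMap]
    exact h q hg

variable {n : ℕ} {W : Set (Fin n ⊕ Fin n → Ω)} (L : IntermediateField ℚ Ω)
  {z : Fin n ⊕ Fin n → Ω}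

omit [IsAlgClosed Ω] in
/-- A polynomial over `L` vanishing at a generic point of `I_L(W)` vanishes on `W`. [folklore] -/
theorem vanish_of_generic (hz : ∀ p : MvPolynomial (Fin n ⊕ Fin n) L, aeval z p = 0 ↔ p ∈ vanishingIdeal L W)
    {p : MvPolynomial (Fin n ⊕ Fin n) L} (hp : aeval z p = 0) : ∀ w ∈ W, aeval w p = 0 :=
  mem_vanishingIdeal_iff.1 ((hz p).1 hp)

omit [IsAlgClosed Ω] in
/-- **Multiplicative coordinates of a generic point are non-zero** when `W` meets the torus.
[cite: BaysKirby2018ANT, Lemma 8.3 (proof)] -/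
theorem generic_ne_zero (hz : ∀ p : MvPolynomial (Fin n ⊕ Fin n) L, aeval z p = 0 ↔ p ∈ vanishingIdeal L W)
    (hne : (W ∩ torusLocus Ω n).Nonempty) (j : Fin n) : z (Sum.inr j) ≠ 0 := by
  intro h0
  obtain ⟨w, hwW, hwT⟩ := hne
  have := vanish_of_generic L hz (p := X (Sum.inr j)) (by rw [aeval_X, h0]) w hwW
  rw [aeval_X] at this
  exact (mem_torusLocus_iff.1 hwT) j this

omit [IsAlgClosed Ω] in
/-- **Additive freeness at a generic point**: no rational combination of the additive coordinates
lies in `L`. [cite: BaysKirby2018ANT, Lemma 8.3 (proof)] -/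
theorem generic_xfree (hz : ∀ p : MvPolynomial (Fin n ⊕ Fin n) L, aeval z p = 0 ↔ p ∈ vanishingIdeal L W)
    (hfree : IsAddFree Ω n (W ∩ torusLocus Ω n))
    (q : Fin n → ℚ) (hq : (∑ j, q j • z (Sum.inl j)) ∈ (L : Set Ω)) : q = 0 := by
  classical
  obtain ⟨c, hc⟩ : ∃ c : L, (c : Ω) = ∑ j, q j • z (Sum.inl j) := ⟨⟨_, hq⟩, rfl⟩
  obtain ⟨N, m, hN, hm⟩ := ZilberGSGC.exists_intVec_eq_natMul q
  -- the polynomial `∑ q_j X_j - c` vanishes at `z`, hence on `W`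
  set p : MvPolynomial (Fin n ⊕ Fin n) L := ∑ j, C (q j : L) * X (Sum.inl j) - C c with hpdef
  have hpz : aeval z p = 0 := by
    simp only [hpdef, map_sub, map_sum, map_mul, aeval_C, aeval_X, sub_eq_zero]
    rw [show (algebraMap L Ω) c = (c : Ω) from rfl, hc]
    refine Finset.sum_congr rfl fun j _ => ?_
    rw [Rat.smul_def, map_ratCast]
  have hW : ∀ w ∈ W, ∑ j, (q j : Ω) * w (Sum.inl j) = c := by
    intro w hw
    have := vanish_of_generic L hz hpz w hw
    simp only [hpdef, map_sub, map_sum, map_mul, aeval_C, aeval_X, sub_eq_zero, map_ratCast] at this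
    exact this
  by_contra hq0
  have hm0 : m ≠ 0 := by
    intro h
    apply hq0
    funext j
    have := hm j
    rw [h, Pi.zero_apply, Int.cast_zero] at this
    have hN0 : (N : ℚ) ≠ 0 := Nat.cast_ne_zero.2 hN.ne'
    exact (mul_eq_zero.1 this.symm).resolve_left hN0
  refine hfree m hm0 ⟨(N : Ω) * c, fun w hw => ?_⟩
  rw [← hW w hw.1, Finset.mul_sum]
  refine Finset.sum_congr rfl fun j _ => ?_
  have : ((m j : ℚ) : Ω) = ((N : ℚ) * q j : ℚ) := by rw [hm j]
  rw [show (m j : Ω) = ((m j : ℚ) : Ω) by norm_cast, this]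
  push_cast; ring

omit [IsAlgClosed Ω] in
/-- **Multiplicative freeness at a generic point**: no non-trivial monomial in the multiplicative
coordinates lies in `L`. [cite: BaysKirby2018ANT, Lemma 8.3 (proof)] -/
theorem generic_yfree (hz : ∀ p : MvPolynomial (Fin n ⊕ Fin n) L, aeval z p = 0 ↔ p ∈ vanishingIdeal L W)
    (hne : (W ∩ torusLocus Ω n).Nonempty) (hfree : IsMulFree Ω n (W ∩ torusLocus Ω n))
    (m : Fin n → ℤ) (hm : (∏ j, z (Sum.inr j) ^ m j) ∈ (L : Set Ω)) : m = 0 := by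
  classical
  by_contra hm0
  obtain ⟨c, hc⟩ : ∃ c : L, (c : Ω) = ∏ j, z (Sum.inr j) ^ m j := ⟨⟨_, hm⟩, rfl⟩
  have hy : ∀ j, z (Sum.inr j) ≠ 0 := generic_ne_zero L hz hne
  set A : MvPolynomial (Fin n ⊕ Fin n) L := ∏ i, X (Sum.inr i) ^ (m i).toNat with hA
  set B : MvPolynomial (Fin n ⊕ Fin n) L := ∏ i, X (Sum.inr i) ^ (-m i).toNat with hB
  have hAeval : ∀ w : Fin n ⊕ Fin n → Ω, aeval w A = ∏ i, w (Sum.inr i) ^ (m i).toNat := by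
    intro w; simp [hA, map_prod]
  have hBeval : ∀ w : Fin n ⊕ Fin n → Ω, aeval w B = ∏ i, w (Sum.inr i) ^ (-m i).toNat := by
    intro w; simp [hB, map_prod]
  have hpz : aeval z (A - C c * B) = 0 := by
    have hzc : (∏ i, z (Sum.inr i) ^ (m i).toNat) = (c : Ω) * ∏ i, z (Sum.inr i) ^ (-m i).toNat := by
      have hne' : ∏ i, z (Sum.inr i) ^ (-m i).toNat ≠ 0 :=
        Finset.prod_ne_zero_iff.2 fun i _ => pow_ne_zero _ (hy i)
      have := hc
      rw [ChartTransfer.prod_zpow_eq_div _ hy, eq_div_iff hne'] at this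
      exact this.symm
    rw [map_sub, map_mul, aeval_C, hAeval, hBeval, hzc]
    exact sub_self _
  refine hfree m hm0 ⟨c, fun w hw => ?_⟩
  have h1 := vanish_of_generic L hz hpz w hw.1
  rw [map_sub, map_mul, aeval_C, hAeval, hBeval, sub_eq_zero] at h1
  have hne' : ∏ i, w (Sum.inr i) ^ (-m i).toNat ≠ 0 :=
    Finset.prod_ne_zero_iff.2 fun i _ => pow_ne_zero _ ((mem_torusLocus_iff.1 hw.2) i)
  rw [ChartTransfer.prod_zpow_eq_div _ (mem_torusLocus_iff.1 hw.2), div_eq_iff hne', h1]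
  rfl

/-- **Rotundity at a generic point**: `rk M ≤ td([M] z / L)` (rotundity descends to the
`L`-points, whose generic point is `z`; Bays–Kirby 2018, proof of Thm 8.2).
[cite: BaysKirby2018ANT, Thm 8.2 (proof) and Lemma 8.3] -/
theorem generic_rotund (hL : IsAlgClosed L) (hW : IsIrreducibleClosed Ω W)
    {G : Set (MvPolynomial (Fin n ⊕ Fin n) L)} (hWG : W = zeroLocus Ω (Ideal.span G))
    (hz : ∀ p : MvPolynomial (Fin n ⊕ Fin n) L, aeval z p = 0 ↔ p ∈ vanishingIdeal L W)
    (hne : (W ∩ torusLocus Ω n).Nonempty) (hrot : IsRotund Ω n (W ∩ torusLocus Ω n))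
    (M : Matrix (Fin n) (Fin n) ℤ) :
    ((M.map (Int.cast : ℤ → ℚ)).rank : ℕ∞) ≤ (algMatroid Ω).relRank (L : Set Ω) (range (matrixAct M z)) := by
  classical
  haveI := hL
  haveI : (vanishingIdeal Ω W).IsPrime := hW.2
  set P := ChartTransfer.contract (M := L) (vanishingIdeal Ω W) with hP
  have hPeq : P = vanishingIdeal L W := contract_vanishingIdeal_eq L W
  have hzP : IsGenericPt P z := fun a => by rw [hPeq]; exact hz a
  have hrotL := ChartTransfer.isRotund_zeroLocus_contract (M := L) hW hWG hne hrot
  have hneL := ChartTransfer.nonempty_zeroLocus_contract_inter_torus (M := L) hW hne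
  have h1 := hrotL M
  rw [zariskiDim_image_matrixAct_eq P hzP hneL M] at h1
  -- `toNat (trdeg L L[[M] z]) = relRank L ([M] z)`
  have hfin : (algMatroid Ω).relRank (L : Set Ω) (range (matrixAct M z)) ≠ ⊤ :=
    ((algMatroid Ω).relRank_lt_top_of_finite _ ((finite_range _).subset sdiff_subset)).ne
  have h2 : (Cardinal.toNat (Algebra.trdeg L
      (aeval (matrixAct M z) : MvPolynomial (Fin n ⊕ Fin n) L →ₐ[L] Ω).range) : ℕ∞) =
      (algMatroid Ω).relRank (L : Set Ω) (range (matrixAct M z)) := by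
    rw [← Algebra.adjoin_range_eq_range_aeval, ← ZilberSaturationMain.toENat_trdeg_algebra_adjoin_eq_relRank,
      ← Cardinal.toNat_toENat, ENat.coe_toNat]
    rw [ZilberSaturationMain.toENat_trdeg_algebra_adjoin_eq_relRank]
    exact hfin
  rw [← h2]
  exact_mod_cast (WithBot.coe_le_coe.1 h1)

end AdmissibleGeneric

/-! ### Properties of the limit model, IV: strong exponential-algebraic closedness -/

section SEAC

variable {K : Type u} [Field K] [CharZero K] {D : Submodule ℚ K} {θ : K → K} {τ : K}
variable (hK : IsStdKernelPartialExpField K D θ τ) (sch : Sched K)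
include hK

omit hK in
/-- Evaluating a polynomial whose coefficients were moved from a subfield `L'` into a larger
intermediate field `L`. [folklore] -/
theorem aeval_map_codRestrict {L' : Subfield (Om K)} {L : IntermediateField ℚ (Om K)}
    (h : ∀ x : L', (x : Om K) ∈ L) {ι' : Type*} (w : ι' → Om K) (p : MvPolynomial ι' L') :
    aeval w (MvPolynomial.map ((L'.subtype).codRestrict L h) p) = aeval w p := by
  rw [aeval_def, aeval_def, eval₂_map]
  rfl

/-- **Realising an admissible generic point** (Bays–Kirby 2018, Lemma 8.3 (⟸) inside the
construction of Thm 5.9): for an irreducible rotund free `W` meeting the torus and a finite set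
`S`, at some stage `t` whose domain contains `S` and the coefficients of equations for `W`, the
schedule adjoins a point `z = (x, E x) ∈ W` generic over the (algebraically closed) field of the
stage, with `x` rationally free over it. [cite: BaysKirby2018ANT, Lemma 8.3 and Thm 5.9] -/
theorem exists_realised {n : ℕ} {W : Set (Fin n ⊕ Fin n → Om K)} (hW : IsIrreducibleClosed (Om K) W)
    (hne : (W ∩ torusLocus (Om K) n).Nonempty) (hrot : IsRotund (Om K) n (W ∩ torusLocus (Om K) n))
    (hafree : IsAddFree (Om K) n (W ∩ torusLocus (Om K) n))
    (hmfree : IsMulFree (Om K) n (W ∩ torusLocus (Om K) n)) {S : Set (Om K)} (hS : S.Finite) :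
    ∃ (t : ℕ) (z : Fin n ⊕ Fin n → Om K), S ⊆ (chain hK sch t).Λ ∧ z ∈ W ∧
      (∀ j, z (Sum.inl j) ∈ (chain hK sch (t + 1)).Λ) ∧
      (∀ j, (chain hK sch (t + 1)).E (z (Sum.inl j)) = z (Sum.inr j)) ∧
      (∀ q : Fin n → ℚ, (∑ j, q j • z (Sum.inl j)) ∈ acl (chain hK sch t).gens' → q = 0) ∧
      (∀ p : MvPolynomial (Fin n ⊕ Fin n) (chain hK sch t).fld,
        aeval z p = 0 ↔ p ∈ vanishingIdeal (chain hK sch t).fld W) := by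
  classical
  obtain ⟨G, hWG⟩ := exists_finset_eq_zeroLocus hW.1
  obtain ⟨k, hk⟩ := sch.item_surjective ⟨n, G⟩
  -- the coefficients of `G`, and a stage containing them and `S`
  set Cf : Set (Om K) := ⋃ g ∈ G, (↑g.coeffs : Set (Om K)) with hCf
  have hCffin : Cf.Finite := G.finite_toSet.biUnion fun g _ => g.coeffs.finite_toSet
  obtain ⟨t₀, ht₀⟩ := exists_stage_of_finite hK sch (hS.union hCffin)
  set t := Nat.pair k (4 * t₀ + 3) with ht
  have ht₀t : t₀ ≤ t := le_pair_task k t₀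
  have hkt := unpair_pair_task k t₀
  set σ := chain hK sch t with hσ
  set L := σ.fld with hL
  have hΛt : S ∪ Cf ⊆ (σ.Λ : Set (Om K)) := ht₀.trans (Λ_mono hK sch ht₀t)
  have hΛL : (σ.Λ : Set (Om K)) ⊆ (L : Set (Om K)) := by
    rw [hL, coe_aclField]
    exact fun v hv => subset_acl _ (@GammaField.mem_gens_of_mem _ _ _ σ.E.inst _ _ hv)
  have hcoef : ∀ g ∈ G, (↑g.coeffs : Set (Om K)) ⊆ (L : Set (Om K)) := fun g hg c hc =>
    hΛL (hΛt (Or.inr (mem_iUnion₂.2 ⟨g, hg, hc⟩)))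
  have hWGL := eq_zeroLocus_span_preimage L hWG hcoef
  -- the prime ideal of `W` over `L` and a generic point
  haveI : (vanishingIdeal (Om K) W).IsPrime := hW.2
  haveI hPprime : (vanishingIdeal L W).IsPrime := by
    rw [← contract_vanishingIdeal_eq]; infer_instance
  obtain ⟨z, hz⟩ := exists_genericPt L (C := σ.gens') (by rw [hL, coe_aclField])
    (fun T hT => σ.exists_fresh fresh_om hT) (vanishingIdeal L W)
  -- admissibility of `z`
  have hLset : (L : Set (Om K)) = acl σ.gens' := by rw [hL, coe_aclField]
  have hadm : Admissible σ n G (fun j => z (Sum.inl j)) (fun j => z (Sum.inr j)) := by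
    have hxy : Sum.elim (fun j => z (Sum.inl j)) (fun j => z (Sum.inr j)) = z := by
      ext i; cases i <;> rfl
    refine ⟨generic_ne_zero L hz hne, fun q hq => generic_xfree L hz hafree q (by rwa [hLset]),
      fun m hm => generic_yfree L hz hne hmfree m (by rwa [hLset]), fun M => ?_, fun p => ?_⟩
    · rw [hxy, ← hLset]
      exact generic_rotund L (isAlgClosed_aclField _) hW hWGL hz hne hrot M
    · rw [hxy, ← hWG]; exact hz p
  -- the schedule realises an admissible point at time `t`
  have key : ∀ it : Σ n : ℕ, Finset (MvPolynomial (Fin n ⊕ Fin n) (Om K)), sch.item k = it →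
      (∃ xy : (Fin it.1 → Om K) × (Fin it.1 → Om K), Admissible σ it.1 it.2 xy.1 xy.2) →
      ∃ x y : Fin it.1 → Om K, Admissible σ it.1 it.2 x y ∧
        (∀ j, x j ∈ (chain hK sch (t + 1)).Λ) ∧ ∀ j, (chain hK sch (t + 1)).E (x j) = y j := by
    rintro it rfl hex
    exact exists_point hK sch hkt.1 hkt.2 hex
  obtain ⟨x, y, hadm', hx, hE⟩ := key ⟨n, G⟩ hk ⟨(_, _), hadm⟩
  obtain ⟨-, hxfree, -, -, hgen⟩ := hadm'
  rw [← hWG] at hgen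
  refine ⟨t, Sum.elim x y, (subset_union_left.trans hΛt), ?_, hx, hE, hxfree, hgen⟩
  -- `(x, y) ∈ W`
  rw [hWGL, zeroLocus_span]
  intro q hq
  rw [hgen q, mem_vanishingIdeal_iff]
  intro w hw
  rw [hWG, zeroLocus_span] at hw
  rw [← aeval_map_algebraMap (Om K)]
  exact hw _ hq

/-- **The model is strongly exponentially-algebraically closed.**
[cite: BaysKirby2018ANT, Thm 5.9 and Lemma 8.3] -/
theorem isStronglyExpAlgClosed : @IsStronglyExpAlgClosed (Om K) _ (instModel hK sch) := by
  letI := instModel hK sch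
  intro n W hW hne hrot hafree hmfree _ A F₀ _
  obtain ⟨t, z, hS, hzW, hx, hE, -, hgen⟩ :=
    exists_realised hK sch hW hne hrot hafree hmfree (S := (↑A ∪ ↑F₀ : Set (Om K)))
      (A.finite_toSet.union F₀.finite_toSet)
  refine ⟨z, ⟨hzW, fun i => ?_⟩, hzW, ?_⟩
  · rw [exp_eq hK sch (hx i), hE i]
  · set L := (chain hK sch t).fld
    set L' := Subfield.closure (↑A ∪ ↑F₀ : Set (Om K))
    have hsub : ∀ c : L', (c : Om K) ∈ L := by
      have hle : L' ≤ L.toSubfield := by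
        refine Subfield.closure_le.2 (hS.trans ?_)
        intro v hv
        change v ∈ L
        rw [mem_aclField_iff]
        exact subset_acl _ (@GammaField.mem_gens_of_mem _ _ _ (chain hK sch t).E.inst _ _ hv)
      exact fun c => hle c.2
    refine le_antisymm (fun p hp => ?_) (vanishingIdeal_anti_mono (singleton_subset_iff.2 hzW))
    rw [mem_vanishingIdeal_iff] at hp ⊢
    have hp0 : aeval z (MvPolynomial.map ((L'.subtype).codRestrict L hsub) p) = 0 := by
      rw [aeval_map_codRestrict]; exact hp z rfl
    have hmem := (hgen _).1 hp0
    intro w hw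
    rw [← aeval_map_codRestrict hsub]
    exact mem_vanishingIdeal_iff.1 hmem w hw

/-- **Axiom 4 over the base**: generic points with `x` `ℤ`-linearly independent over
`span(ι(D) ∪ A)`. [cite: BaysKirby2018ANT, Lemma 8.3] -/
theorem axiom4 : letI := instModel hK sch
    ∀ (n : ℕ) (W : Set (Fin n ⊕ Fin n → Om K)), IsIrreducibleClosed (Om K) W →
      (W ∩ torusLocus (Om K) n).Nonempty → IsRotund (Om K) n (W ∩ torusLocus (Om K) n) →
      IsAddFree (Om K) n (W ∩ torusLocus (Om K) n) → IsMulFree (Om K) n (W ∩ torusLocus (Om K) n) →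
      zariskiDim (Om K) W = n →
      ∀ A : Finset (Om K), ∃ z ∈ W ∩ expGraph (Om K) n,
        ∀ m : Fin n → ℤ, (∑ i, (m i : Om K) * z (Sum.inl i)) ∈
          Submodule.span ℚ (emb K '' (D : Set K) ∪ ↑A) → m = 0 := by
  letI := instModel hK sch
  intro n W hW hne hrot hafree hmfree _ A
  obtain ⟨t, z, hS, hzW, hx, hE, hxfree, -⟩ :=
    exists_realised hK sch hW hne hrot hafree hmfree (S := (↑A : Set (Om K))) A.finite_toSet
  refine ⟨z, ⟨hzW, fun i => by rw [exp_eq hK sch (hx i), hE i]⟩, fun m hm => ?_⟩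
  have hspan : Submodule.span ℚ (emb K '' (D : Set K) ∪ ↑A) ≤ (chain hK sch t).Λ := by
    rw [Submodule.span_le]
    refine union_subset ?_ hS
    rintro _ ⟨d, hd, rfl⟩
    exact Λ_mono hK sch (Nat.zero_le t) (by rw [chain_zero_Λ]; exact mem_baseSub_iff.2 ⟨d, hd, rfl⟩)
  have hmem : (∑ j, ((m j : ℚ)) • z (Sum.inl j)) ∈ acl (chain hK sch t).gens' := by
    have : (∑ j, ((m j : ℚ)) • z (Sum.inl j)) = ∑ i, (m i : Om K) * z (Sum.inl i) :=
      Finset.sum_congr rfl fun j _ => by rw [Rat.smul_def, Rat.cast_intCast]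
    rw [this]
    exact subset_acl _ (@GammaField.mem_gens_of_mem _ _ _ (chain hK sch t).E.inst _ _ (hspan hm))
  have h0 := hxfree _ hmem
  funext j
  have := congrFun h0 j
  simpa using this

end SEAC

/-! ### The countable model -/

section Model

/-- **The countable model over a finitely generated partial exponential field with standard kernel**
(Bays–Kirby 2018, Thm 5.9 / Notation 5.10 with §9.2, together with Lemma 8.3, and the infinite
dimensionality used in Thm 6.9): for `F_base = (K, D, θ, τ)` there is a countable algebraically
closed exponential field `M ⊇ K` with surjective exponential map extending `θ`, kernel exactly
`τℤ`, `ι(D) ◁ M`, strongly exponentially-algebraically closed, satisfying axiom 4 over the base,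
and of infinite `ecl`-dimension. No Schanuel property is assumed or asserted.
[cite: BaysKirby2018ANT, Thm 5.9, Lemma 8.3, Thm 6.9, §9.2] -/
theorem exists_countable_seac_model {K : Type} [Field K] [CharZero K] {D : Submodule ℚ K}
    {θ : K → K} {τ : K} (hK : IsStdKernelPartialExpField K D θ τ) :
    ∃ (M : Type) (_ : Field M) (_ : CharZero M) (_ : ExponentialRing M) (ιM : K →+* M),
      IsAlgClosed M ∧ Countable M ∧ IsSurjectiveOntoUnits M ∧
      (∀ x ∈ D, exp (ιM x) = ιM (θ x)) ∧
      expKernel M = AddSubgroup.zmultiples (ιM τ) ∧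
      GammaField.IsStrong (Submodule.span ℚ (ιM '' (D : Set K))) ∧
      IsStronglyExpAlgClosed M ∧
      (∀ (n : ℕ) (W : Set (Fin n ⊕ Fin n → M)), IsIrreducibleClosed M W →
        (W ∩ torusLocus M n).Nonempty → IsRotund M n (W ∩ torusLocus M n) →
        IsAddFree M n (W ∩ torusLocus M n) → IsMulFree M n (W ∩ torusLocus M n) →
        zariskiDim M W = n →
        ∀ A : Finset M, ∃ z ∈ W ∩ expGraph M n,
          ∀ m : Fin n → ℤ, (∑ i, (m i : M) * z (Sum.inl i)) ∈
            Submodule.span ℚ (ιM '' (D : Set K) ∪ ↑A) → m = 0) ∧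
      (∀ C : Set M, C.Finite → ∃ d, d ∉ ecl C) := by
  obtain ⟨sch⟩ := nonempty_sched hK
  haveI : Countable K := countable_of_isStdKernel hK
  exact ⟨Om K, inferInstance, inferInstance, instModel hK sch, emb K, inferInstance, countable_om K,
    isSurjectiveOntoUnits hK sch, fun x hx => exp_emb hK sch hx, expKernel_eq hK sch,
    isStrong_base hK sch, isStronglyExpAlgClosed hK sch, axiom4 hK sch, exists_notMem_ecl hK sch⟩

end Model

end BKModel

end Literature.NumberTheory.Transcendental
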